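import Mathlib

/-!
# SoloInformedCyclicSocle — the Nakayama step of THEOREM Σ (T1) (Part II §7.11 (14))

In THEOREM Σ of §7.11 (14) the 5-class group `A` of `L = F(μ₅, ε^{1/5})` is a CYCLIC module over the local ring
`Λ = ℤ₅[Gal(L/F(μ₅))]` (genus theory: `A/(σ-1)A ≅ Cl(F(μ₅)){5}` is cyclic), and the zero of the unit Steinberg symbol is read off
the inclusion `A^{G} = A[σ - 1] ⊆ 𝔪A` when `σ ≠ 1` on `A`.  The pure-algebra content of that step is the following lemma, proved
here over an arbitrary commutative local ring: in a cyclic module `A = R•a₀` over a local ring `R`, if `x ∈ R` does NOT kill `A`,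
then every `x`-torsion element of `A` lies in `𝔪•a₀` (i.e. in `𝔪A`).  Contrapositive (Nakayama for cyclic modules): an `x`-torsion
element outside `𝔪A` generates `A`, forcing `xA = 0`.

* `soloInformed_generator_of_unit_coeff` : `r` a unit ⇒ `r • a₀` generates the cyclic module `R • a₀`.
* `soloInformed_torsion_in_maximal_of_cyclic` : the lemma above.
* `soloInformed_image_of_torsion_in_maximal` : its image form under a linear map `N` (the (T1) shape `N(A[x]) ⊆ 𝔪B`).
-/

namespace Summit.Langlands.Langlands.Theorems

/-- In a cyclic module `A = R • a₀`, a unit multiple of the generator is again a generator. -/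
theorem soloInformed_generator_of_unit_coeff {R A : Type*} [CommRing R] [AddCommGroup A] [Module R A]
    (a₀ : A) (hgen : ∀ a : A, ∃ r : R, a = r • a₀) (u : Rˣ) :
    ∀ a : A, ∃ r : R, a = r • ((u : R) • a₀) := by
  intro a
  obtain ⟨r, rfl⟩ := hgen a
  refine ⟨r * (↑u⁻¹ : R), ?_⟩
  rw [smul_smul, mul_assoc, Units.inv_mul, mul_one]

/-- THE NAKAYAMA STEP OF THEOREM Σ (T1): over a commutative local ring `R` with maximal ideal `𝔪`, let `A = R • a₀` be a cyclic
module and `x ∈ R` an element that does not annihilate `A`.  Then every `x`-torsion element `c` of `A` is of the form `m • a₀` with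
`m ∈ 𝔪`; in particular the `x`-torsion ("socle in the `x`-direction", e.g. the `Gal`-invariants `A^{σ}` for `x = σ - 1`) lies in `𝔪A`. -/
theorem soloInformed_torsion_in_maximal_of_cyclic {R A : Type*} [CommRing R] [IsLocalRing R] [AddCommGroup A] [Module R A]
    (a₀ : A) (hgen : ∀ a : A, ∃ r : R, a = r • a₀) (x : R) (hx : ∃ a : A, x • a ≠ 0)
    (c : A) (hc : x • c = 0) : ∃ m ∈ IsLocalRing.maximalIdeal R, c = m • a₀ := by
  obtain ⟨r, rfl⟩ := hgen c
  by_cases hr : r ∈ IsLocalRing.maximalIdeal R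
  · exact ⟨r, hr, rfl⟩
  · exfalso
    have hu : IsUnit r := by
      rw [IsLocalRing.mem_maximalIdeal, mem_nonunits_iff, not_not] at hr
      exact hr
    obtain ⟨u, rfl⟩ := hu
    -- `x` kills the generator `a₀ = u⁻¹ • (u • a₀)`, hence all of `A`
    have h1 : x • a₀ = 0 := by
      have h2 : (↑u⁻¹ : R) • (x • ((↑u : R) • a₀)) = 0 := by rw [hc, smul_zero]
      rwa [smul_smul, smul_smul, mul_comm (↑u⁻¹ : R) x, mul_assoc, Units.inv_mul, mul_one] at h2
    obtain ⟨a, ha⟩ := hx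
    obtain ⟨s, rfl⟩ := hgen a
    rw [smul_comm, h1, smul_zero] at ha
    exact ha rfl

/-- THE (T1) SHAPE: with `N : A →ₗ[R] B` any `R`-linear map (in §7.11 (14): the norm / genus map `A ↠ A/(σ-1)A ≅ B = Cl(F(μ₅)){5}`),
the image of an `x`-torsion element of the cyclic module `A = R • a₀` (on which `x` acts non-trivially) lies in `𝔪 • N(a₀) ⊆ 𝔪B`.
For `B` of exponent dividing the residue characteristic this says `N(A[x]) ⊆ 𝔪B = pB` — the vanishing of the unit symbol in (T1). -/
theorem soloInformed_image_of_torsion_in_maximal {R A B : Type*} [CommRing R] [IsLocalRing R] [AddCommGroup A] [Module R A]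
    [AddCommGroup B] [Module R B] (N : A →ₗ[R] B)
    (a₀ : A) (hgen : ∀ a : A, ∃ r : R, a = r • a₀) (x : R) (hx : ∃ a : A, x • a ≠ 0)
    (c : A) (hc : x • c = 0) : ∃ m ∈ IsLocalRing.maximalIdeal R, N c = m • N a₀ := by
  obtain ⟨m, hm, rfl⟩ := soloInformed_torsion_in_maximal_of_cyclic a₀ hgen x hx c hc
  exact ⟨m, hm, by rw [map_smul]⟩

end Summit.Langlands.Langlands.Theorems
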